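import Summits.Ventures.CertifiedManyBodySolver.Theses.TcThermcert1
import HarnessLib

/-!
# Theorems/TcThermcert1Assembly.lean — the Assembly item of route «hubbard-tc-thermcert-1» (`Theses/TcThermcert1.lean`), PROVED

The route (cell `pub/hubbard-tc`, MO-S3; director-hubbard D-0154 (1) «THERMAL CERTIFICATES»; hubbard-tc lead birth packet v4, RULINGS R117 (K3 dropped: the
`∃`-window leaf is vacuous) and R121 (K2 = BOX transport on the La₂CuO₄ object-E box `U/t ∈ [7.9, 14.7]`, not a ray)) has two cruxes and this assembly:
`Assembly := ThermalStiffnessCeilingU8b10_le_1o8 → ThermalStiffnessCeilingBoxb10_le_9o71 → S3ThermalTcTenthBox_n7o8_tp0`. K1 (the single-temperature thermal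
flux-stiffness ceiling `1/8` at `β·t = 10`, `(U, n, t′) = (8, 7/8, 0)`) fed to K2 (its box transport to the leaf `9/71` at every `U ∈ [79/10, 147/10]`, same `β`) is
exactly the hypothesis of the tree's rung-1 socket instance `ThermalRungLeaves.S3ThermalTcTenthBox_n7o8_tp0_of_leafAtBeta_ten` (`Observables/ThermalRungLeaves.lean`,
hubbard-tc-mod-2 append p609884: the single-point Nelson–Kosterlitz closure `ThermalKTDictionaryAt.le_inv_of_leafAtBeta` at `β·t = 10` with the numeric seam
`(π/4)·(9/71) < 1/10`, `Real.pi_lt_d2`). Pure logic; provable now; it moves nothing about K1/K2 (both OPEN: a certified `T > 0` current–current word on the box is the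
missing object — hubbard-tc-mod-2 THERMCERT-KT-PRICES v1: every energy-class certificate saturates at `θ* = 0.2011 > 1/10`).
HONEST FRAMING: one-sided CEILINGS on a Kosterlitz–Thouless transition temperature under the THERMAL KT DICTIONARY (Nelson–Kosterlitz stability and the thermal
identification are HYPOTHESES of `ThermalKTDictionaryAt`); a ceiling never asserts superconductivity; NO lower bound on `T_c` is claimed; no number of record moves.
Seat hubbard-tc-mod-3 g10 (Assembly prover by RULINGS R116/R117/R123), text = the lead's packet `AssemblyProof.lean` (v4 term per R121) with docstrings.
References: HazraVermaRanderia2019 eqs. (2)–(4); NelsonKosterlitz1977 eq. (1).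
-/

namespace Summit.Ventures.CertifiedManyBodySolver.Theses.TcThermcert1

open Summit.Ventures.CertifiedManyBodySolver.Observables
open Summit.Ventures.CertifiedManyBodySolver.Observables.ThermalRungLeaves

/-- **The Assembly of route «hubbard-tc-thermcert-1» (v4)**: K1 → K2 → `S3ThermalTcTenthBox_n7o8_tp0` — K2 applied to K1 is the box leaf
`∀ U ∈ [79/10, 147/10], ObsThermalStiffnessSeqCeilingAtBeta 0 U (7/8) 10 (9/71)`, which the rung-1 socket instance `S3ThermalTcTenthBox_n7o8_tp0_of_leafAtBeta_ten`
turns into the tenth-box ceiling (`(π/4)·(9/71) < 1/10`). [cite: HazraVermaRanderia2019, eqs. (2)–(4)] -/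
theorem Assembly_holds : Assembly := fun h₁ h₂ =>
  S3ThermalTcTenthBox_n7o8_tp0_of_leafAtBeta_ten (h₂ h₁)

/-- **The same Assembly, self-contained spelling** (the single-point closure `ThermalKTDictionaryAt.le_inv_of_leafAtBeta` at `β·t = 10` applied directly on the box,
numeric seam `(π/4)·(9/71) < 1/10` from `Real.pi_lt_d2`). [cite: NelsonKosterlitz1977, eq. (1)] -/
theorem Assembly_holds' : Assembly := by
  intro h₁ h₂ U hU hU' ρe Tc hT
  have hlt : Real.pi / 4 * (((9 / 71 : ℚ) : ℚ) : ℝ) < 1 / 10 := by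
    have hπ : Real.pi < 3.15 := Real.pi_lt_d2
    push_cast
    nlinarith
  have h := hT.le_inv_of_leafAtBeta (β := 10) (by norm_num) (h₂ h₁ U hU hU') hlt
  push_cast
  linarith

end Summit.Ventures.CertifiedManyBodySolver.Theses.TcThermcert1
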